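import Summits.QuantumAdvantage.QuantumAdvantage.Theorems.CharDialPartyDialB2

/-!
# PartyDial (decomp-qadv lens-5 g35), part C — §2: a block-local walk game IS a table game

See part A (`CharDialPartyDialA`) for the node header; memo `NODE-g35.md` (g35 folder of decomp-qadv-lens-5).
-/

set_option autoImplicit false
set_option linter.dupNamespace false

namespace Summit.QuantumAdvantage.QuantumAdvantage.Theorems.PartyDial

open Finset
open Summit.QuantumAdvantage.AdviceFreeQNC0

/-! ## §2  A block-local walk game IS a table game (address decomposition and the register lemma)

Cuts are indexed by an arbitrary finite type `G`; cut `g` sits at POSITION `pos g` (the bits `i < pos g`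
are walked twice), belongs to party `pty g`, may read only block `pty g`; all blocks `< pty g` lie before
the cut and all blocks `> pty g` after it.  The charges are per cut (`e g`).  The route's game `ringWinU c`
is `G = Fin (n+1)`, `pos g = g`, `e g = c + g` (`ringWinU_eq_ringWinE`, definitional); the general form is
what the free-zone reduction of §5 produces. -/

section Game

variable {n : ℕ} {G : Type*} [Fintype G] (bl : Fin n → ℕ) (pos : G → ℕ) (pty : G → ℕ) (e : G → ℕ)
  (y : G → (Fin n → Bool) → Bool)

/-- WIN of the walk game with cuts `G` at positions `pos` and PER-CUT charges `e`. -/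
def ringWinE (u : Fin n → Bool) : Bool :=
  decide ((univ.filter fun g : G =>
    y g u = true ∧ (e g + walkExp u (pos g)) % 3 ≠ 0).card % 2 = 1)

/-- the route's game `ringWinU c` is the game with cuts `Fin (n+1)` at their own positions and charges
`c + g` (definitionally). -/
theorem ringWinU_eq_ringWinE (c : ℕ) (y₀ : Fin (n + 1) → (Fin n → Bool) → Bool) (u : Fin n → Bool) :
    ringWinU c y₀ u = ringWinE (fun g : Fin (n + 1) => g.val) (fun g => c + g.val) y₀ u := rfl

/-- the LOCAL part of the address of cut `g` for party `j`: the block-`j` bits, those before the cut twice. -/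
def locA (j : ℕ) (u : Fin n → Bool) (g : ℕ) : ℕ :=
  SumCodeZero.bw bl j u + (univ.filter fun i : Fin n => bl i = j ∧ i.val < g ∧ u i = true).card

/-- the REGISTER COUNT of party `j` at external phase `φ`: its fired cuts whose address is non-zero
when the other blocks contribute `φ`. -/
def reg (j : ℕ) (u : Fin n → Bool) (φ : ZMod 3) : ℕ :=
  (univ.filter fun g : G => pty g = j ∧ y g u = true ∧
    ((e g + locA bl j u (pos g) : ℕ) : ZMod 3) + φ ≠ 0).card

/-- encode three register parities (an even triple) as an action. -/
def encB (b0 b1 b2 : Bool) : Fin 4 :=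
  if (!b0 && b1 && b2) then 0 else if (b0 && !b1 && b2) then 1 else if (b0 && b1 && !b2) then 2 else 3

/-- `encB` realises an even parity triple as the hit pattern of an action (kernel check over `Bool³ × ℤ/3`). -/
theorem hit_encB : ∀ b0 b1 b2 : Bool, xor b0 (xor b1 b2) = false → ∀ φ : ZMod 3,
    hit (encB b0 b1 b2) φ = (if φ = 0 then b0 else if φ = 1 then b1 else b2) := by
  decide

/-- the PATTERN of party `j` at `u`. -/
def pat (j : ℕ) (u : Fin n → Bool) : Fin 4 :=
  encB (decide (reg bl pos pty e y j u 0 % 2 = 1)) (decide (reg bl pos pty e y j u 1 % 2 = 1))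
    (decide (reg bl pos pty e y j u 2 % 2 = 1))

variable {bl pos pty e y}

/-- every residue is non-zero at exactly two of the three external phases. -/
theorem card_phases_ne (x : ZMod 3) : (univ.filter fun φ : ZMod 3 => x + φ ≠ 0).card = 2 := by
  revert x; decide

/-- **The register lemma**: the three register counts of a party have an even sum
(each fired cut is non-zero at exactly two of the three phases). -/
theorem reg_sum_even (j : ℕ) (u : Fin n → Bool) :
    (reg bl pos pty e y j u 0 + reg bl pos pty e y j u 1 + reg bl pos pty e y j u 2) % 2 = 0 := by
  classical
  set F := univ.filter fun g : G => pty g = j ∧ y g u = true with hF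
  have hreg : ∀ φ : ZMod 3, reg bl pos pty e y j u φ =
      ∑ g ∈ F, (if ((e g + locA bl j u (pos g) : ℕ) : ZMod 3) + φ ≠ 0 then 1 else 0) := by
    intro φ
    unfold reg
    rw [← card_filter]
    congr 1
    ext g
    simp [hF, and_assoc]
  have hsum : ∑ φ : ZMod 3, reg bl pos pty e y j u φ = ∑ g ∈ F, 2 := by
    simp_rw [hreg]
    rw [Finset.sum_comm]
    refine Finset.sum_congr rfl fun g _ => ?_
    rw [← card_phases_ne (((e g + locA bl j u (pos g) : ℕ) : ZMod 3)), card_filter]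
  have h3 : ∑ φ : ZMod 3, reg bl pos pty e y j u φ =
      reg bl pos pty e y j u 0 + reg bl pos pty e y j u 1 + reg bl pos pty e y j u 2 :=
    Fin.sum_univ_three _
  rw [← h3, hsum, sum_const, smul_eq_mul]
  omega

/-- the pattern reproduces the register parities. -/
theorem hit_pat (j : ℕ) (u : Fin n → Bool) (φ : ZMod 3) :
    hit (pat bl pos pty e y j u) φ = decide (reg bl pos pty e y j u φ % 2 = 1) := by
  have hev : xor (decide (reg bl pos pty e y j u 0 % 2 = 1)) (xor (decide (reg bl pos pty e y j u 1 % 2 = 1))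
      (decide (reg bl pos pty e y j u 2 % 2 = 1))) = false := by
    have h := reg_sum_even (bl := bl) (pos := pos) (pty := pty) (e := e) (y := y) j u
    have h2 : decide ((reg bl pos pty e y j u 0 + reg bl pos pty e y j u 1 + reg bl pos pty e y j u 2) % 2 = 1) = false := by
      rw [h]; decide
    rw [SumCodeZero.decide_add_mod_two, SumCodeZero.decide_add_mod_two, Bool.xor_assoc] at h2
    exact h2
  unfold pat
  rw [hit_encB _ _ _ hev φ]
  fin_cases φ <;> rfl

/-- the pattern of party `j` reads only block `j` (when its cuts do). -/
theorem blockLocal_pat (hy : ∀ g, BlockLocal bl (pty g) (y g)) (j : ℕ) :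
    BlockLocal bl j (pat bl pos pty e y j) := by
  have hreg : ∀ (φ : ZMod 3) (u v : Fin n → Bool), (∀ i, bl i = j → u i = v i) →
      reg bl pos pty e y j u φ = reg bl pos pty e y j v φ := by
    intro φ u v huv
    unfold reg
    refine congrArg Finset.card (Finset.filter_congr fun g _ => ?_)
    by_cases hg : pty g = j
    · have hyg : y g u = y g v := hy g u v (fun i hi => huv i (hi.trans hg))
      have hl : locA bl j u (pos g) = locA bl j v (pos g) := by
        unfold locA
        rw [blockLocal_bw j u v huv]
        congr 2
        ext i
        simp only [mem_filter, mem_univ, true_and]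
        constructor
        · rintro ⟨hi, hlt, hu⟩; exact ⟨hi, hlt, (huv i hi) ▸ hu⟩
        · rintro ⟨hi, hlt, hv⟩; exact ⟨hi, hlt, (huv i hi).symm ▸ hv⟩
      rw [hyg, hl]
    · simp [hg]
  intro u v huv
  unfold pat
  rw [hreg 0 u v huv, hreg 1 u v huv, hreg 2 u v huv]

/-- weight = sum of block weights. -/
theorem wt_eq_sum_bw {k : ℕ} (hblk : ∀ i, bl i < k) (u : Fin n → Bool) :
    wt u = ∑ j ∈ range k, SumCodeZero.bw bl j u := by
  unfold wt SumCodeZero.bw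
  rw [card_eq_sum_card_fiberwise (f := bl) (t := range k) (fun i _ => mem_range.2 (hblk i))]
  refine Finset.sum_congr rfl fun j _ => ?_
  congr 1; ext i; simp only [mem_filter, mem_univ, true_and]; tauto

/-- prefix weight, block by block. -/
theorem wtPrefix_eq_sum {k : ℕ} (hblk : ∀ i, bl i < k) (u : Fin n → Bool) (g : ℕ) :
    wtPrefix u g = ∑ j ∈ range k, (univ.filter fun i : Fin n => bl i = j ∧ i.val < g ∧ u i = true).card := by
  unfold wtPrefix
  rw [card_eq_sum_card_fiberwise (f := bl) (t := range k) (fun i _ => mem_range.2 (hblk i))]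
  refine Finset.sum_congr rfl fun j _ => ?_
  congr 1; ext i; simp only [mem_filter, mem_univ, true_and]; tauto

omit [Fintype G] in
/-- **Address decomposition**: for a cut of party `j`, the address splits as LOCAL part + external
PHASE of the cell. -/
theorem addr_decomp {k : ℕ} (hblk : ∀ i, bl i < k)
    (hpast : ∀ (i : Fin n) (g : G), bl i < pty g → i.val < pos g)
    (hfut : ∀ (i : Fin n) (g : G), pty g < bl i → pos g ≤ i.val)
    (g : G) (hj : pty g < k) (u : Fin n → Bool) :
    (((e g + walkExp u (pos g) : ℕ) : ZMod 3)) =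
      ((e g + locA bl (pty g) u (pos g) : ℕ) : ZMod 3) + phase (cvec bl k u) ⟨pty g, hj⟩ := by
  -- prefix counts of the other blocks
  have hpre : ∀ j' ∈ range k, (univ.filter fun i : Fin n => bl i = j' ∧ i.val < pos g ∧ u i = true).card =
      if j' < pty g then SumCodeZero.bw bl j' u else if pty g < j' then 0
      else (univ.filter fun i : Fin n => bl i = pty g ∧ i.val < pos g ∧ u i = true).card := by
    intro j' _
    by_cases h1 : j' < pty g
    · rw [if_pos h1]
      unfold SumCodeZero.bw
      congr 1; ext i
      simp only [mem_filter, mem_univ, true_and]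
      constructor
      · rintro ⟨hi, -, hu⟩; exact ⟨hi, hu⟩
      · rintro ⟨hi, hu⟩; exact ⟨hi, hpast i g (by rw [hi]; exact h1), hu⟩
    · rw [if_neg h1]
      by_cases h2 : pty g < j'
      · rw [if_pos h2, Finset.card_eq_zero, Finset.filter_eq_empty_iff]
        rintro i - ⟨hi, hlt, -⟩
        have := hfut i g (by rw [hi]; exact h2)
        omega
      · rw [if_neg h2]
        have : j' = pty g := by omega
        subst this; rfl
  have hwalk : walkExp u (pos g) = ∑ j' ∈ range k, SumCodeZero.bw bl j' u +
      ∑ j' ∈ range k, (if j' < pty g then SumCodeZero.bw bl j' u else if pty g < j' then 0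
        else (univ.filter fun i : Fin n => bl i = pty g ∧ i.val < pos g ∧ u i = true).card) := by
    unfold walkExp
    rw [wt_eq_sum_bw hblk, wtPrefix_eq_sum hblk, Finset.sum_congr rfl hpre]
  -- regroup in ℕ
  have hjk : pty g ∈ range k := mem_range.2 hj
  have hnat : walkExp u (pos g) = locA bl (pty g) u (pos g) +
      ∑ j' ∈ range k, (if j' < pty g then 2 * SumCodeZero.bw bl j' u
        else if pty g < j' then SumCodeZero.bw bl j' u else 0) := by
    rw [hwalk, ← sum_add_distrib]
    unfold locA
    have : ∀ j' ∈ range k, (SumCodeZero.bw bl j' u +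
        (if j' < pty g then SumCodeZero.bw bl j' u else if pty g < j' then 0
          else (univ.filter fun i : Fin n => bl i = pty g ∧ i.val < pos g ∧ u i = true).card)) =
        (if j' < pty g then 2 * SumCodeZero.bw bl j' u else if pty g < j' then SumCodeZero.bw bl j' u else 0) +
        (if j' = pty g then SumCodeZero.bw bl (pty g) u +
          (univ.filter fun i : Fin n => bl i = pty g ∧ i.val < pos g ∧ u i = true).card else 0) := by
      intro j' _
      by_cases h1 : j' < pty g
      · simp [h1, Nat.ne_of_lt h1]; ring
      · by_cases h2 : pty g < j'
        · simp [h1, h2, (Nat.ne_of_lt h2).symm]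
        · have : j' = pty g := by omega
          subst this; simp
    rw [Finset.sum_congr rfl this, sum_add_distrib, sum_ite_eq' (range k) (pty g), if_pos hjk]
    ring
  have hphase : phase (cvec bl k u) ⟨pty g, hj⟩ =
      ∑ x ∈ range k, (if x < pty g then 2 * ((SumCodeZero.bw bl x u : ℕ) : ZMod 3)
        else if pty g < x then ((SumCodeZero.bw bl x u : ℕ) : ZMod 3) else 0) := by
    unfold phase cvec cl
    rw [← Fin.sum_univ_eq_sum_range (fun x => if x < pty g then 2 * ((SumCodeZero.bw bl x u : ℕ) : ZMod 3)
      else if pty g < x then ((SumCodeZero.bw bl x u : ℕ) : ZMod 3) else 0) k]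
    refine Finset.sum_congr rfl fun i _ => ?_
    simp only [Fin.lt_def]
  have hcast : (((∑ j' ∈ range k, (if j' < pty g then 2 * SumCodeZero.bw bl j' u
        else if pty g < j' then SumCodeZero.bw bl j' u else 0) : ℕ) : ZMod 3)) =
      ∑ x ∈ range k, (if x < pty g then 2 * ((SumCodeZero.bw bl x u : ℕ) : ZMod 3)
        else if pty g < x then ((SumCodeZero.bw bl x u : ℕ) : ZMod 3) else 0) := by
    rw [Nat.cast_sum]
    refine Finset.sum_congr rfl fun x _ => ?_
    split_ifs <;> simp
  rw [hnat, hphase, Nat.cast_add, Nat.cast_add, Nat.cast_add, hcast, add_assoc]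

/-- **WIN = table WIN**: for a block-local strategy, the walk game's outcome at `u` is the table game's
outcome in the cell of `u` under the parties' patterns. -/
theorem ringWinE_eq_tabWin {k : ℕ} (hblk : ∀ i, bl i < k) (hpty : ∀ g, pty g < k)
    (hpast : ∀ (i : Fin n) (g : G), bl i < pty g → i.val < pos g)
    (hfut : ∀ (i : Fin n) (g : G), pty g < bl i → pos g ≤ i.val)
    (u : Fin n → Bool) :
    ringWinE pos e y u = tabWin (cvec bl k u) (fun j => pat bl pos pty e y j.val u) := by
  classical
  have hmod : ∀ x : ℕ, ((x : ZMod 3) ≠ 0) ↔ x % 3 ≠ 0 := by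
    intro x
    rw [show (0 : ZMod 3) = ((0 : ℕ) : ZMod 3) from Nat.cast_zero.symm, Ne, ZMod.natCast_eq_natCast_iff']
  -- the fired non-zero cuts, party by party
  have hS : (univ.filter fun g : G => y g u = true ∧ (e g + walkExp u (pos g)) % 3 ≠ 0).card =
      ∑ j : Fin k, reg bl pos pty e y j.val u (phase (cvec bl k u) j) := by
    rw [card_eq_sum_card_fiberwise (f := fun g => (⟨pty g, hpty g⟩ : Fin k)) (t := univ)
      (fun _ _ => mem_univ _)]
    refine Finset.sum_congr rfl fun j _ => ?_
    unfold reg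
    rw [filter_filter]
    refine congrArg Finset.card (Finset.filter_congr fun g _ => ?_)
    have ha := addr_decomp (e := e) hblk hpast hfut g (hpty g) u
    constructor
    · rintro ⟨⟨hy, hne⟩, hj⟩
      subst hj
      refine ⟨rfl, hy, ?_⟩
      rw [← ha, hmod]; exact hne
    · rintro ⟨hj', hy, hne⟩
      have hj : (⟨pty g, hpty g⟩ : Fin k) = j := Fin.ext hj'
      subst hj
      refine ⟨⟨hy, ?_⟩, rfl⟩
      rw [← hmod, ha]; exact hne
  have hcast : ∀ m : ℕ, (if decide (m % 2 = 1) = true then (1 : ZMod 2) else 0) = (m : ZMod 2) := by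
    intro m
    rw [← ZMod.natCast_mod m 2]
    rcases Nat.mod_two_eq_zero_or_one m with h | h <;> simp [h]
  unfold ringWinE tabWin
  rw [hS]
  simp_rw [hit_pat, hcast]
  rw [← Nat.cast_sum, Bool.eq_iff_iff]
  simp only [decide_eq_true_eq]
  rw [show (1 : ZMod 2) = ((1 : ℕ) : ZMod 2) from Nat.cast_one.symm, ZMod.natCast_eq_natCast_iff']

/-- the LOSE set of the game is the LOSE set of its pattern family. -/
theorem filter_lose_eq_loses {k : ℕ} (hblk : ∀ i, bl i < k) (hpty : ∀ g, pty g < k)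
    (hpast : ∀ (i : Fin n) (g : G), bl i < pty g → i.val < pos g)
    (hfut : ∀ (i : Fin n) (g : G), pty g < bl i → pos g ≤ i.val) :
    (univ.filter fun u : Fin n → Bool => ringWinE pos e y u = false) = loses bl k (pat bl pos pty e y) := by
  unfold loses
  refine Finset.filter_congr fun u _ => ?_
  rw [ringWinE_eq_tabWin hblk hpty hpast hfut u]

end Game

end Summit.QuantumAdvantage.QuantumAdvantage.Theorems.PartyDial
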